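import Literature.NumberTheory.EllipticCurves.ModularPolynomialDegY
import Literature.NumberTheory.Transcendental.ModularRelationsPadic
import Literature.NumberTheory.Transcendental.MahlerManinConclusion
import Literature.NumberTheory.EllipticCurves.PAdicHeightsLInvariantProofs
import HarnessLib

/-!
# The Mahler–Manin theorem and `𝓛_p(E) ≠ 0` from the height of the modular polynomials

Everything in this file is **proved**; there are no new definitions.  We combine

* `mahlerManinPadic_of_relations` (`MahlerManinConclusion.lean`): the `p`-adic proof of the
  Mahler–Manin conjecture after Barré-Sirieix–Diaz–Gramain–Philibert (1996) from prime-level integer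
  modular relations `Φ_ℓ(J(q^ℓ), J(q)) = 0` with controlled degrees and coefficients;
* the tree's integer modular equations `Φ_ℓ = intModularPolynomial ℓ ∈ ℤ[Y][X]` (Cox Thm. 11.18 (i),
  `ModularPolynomialIntegral.lean`), monic of degree `ℓ + 1` in `X`, of degree `≤ ℓ + 1` in `Y`
  (`natDegree_coeff_intModularPolynomial_le`, `ModularPolynomialDegY.lean`), mapping to the complex
  `modularPolynomial ℓ` with `Φ_ℓ(j(ℓτ), j(τ)) = 0`;
* `modularRelation_padic` (`ModularRelationsPadic.lean`): hence `Φ_ℓ(J(q^ℓ), J(q)) = 0` in `ℚ_p`,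

and obtain:

* `mahlerManinPadic_of_modularPolynomial_height` — **`MahlerManinPadic` (BDGP 1996, Théorème 1,
  `p`-adic case) follows from the single remaining classical input**
  (H) *the coefficients of `Φ_ℓ` are `≤ exp(c ℓ √ℓ)` in absolute value, for an absolute constant `c`
  and all primes `ℓ`* — a weak form of P. Cohen's theorem `h(Φ_ℓ) = 6(ℓ+1)(log ℓ + O(1))` (1984),
  e.g. `h(Φ_ℓ) ≤ 6ℓ log ℓ + 16ℓ + 14√ℓ log ℓ` (Bröker–Sutherland 2010, Thm. 1), see
  `mahlerManinPadic_of_brokerSutherland`;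
* `lInvariant_ne_zero_of_modularPolynomial_height`, `lInvariant_ne_zero_of_brokerSutherland` — hence
  Mazur–Tate–Teitelbaum's **`𝓛_p(E) = log_p q_E / ord_p q_E ≠ 0`**
  (`WeierstrassCurve.LInvariant_ne_zero`, via `WeierstrassCurve.LInvariant_ne_zero_of_mahlerManin`).

So the trust base of `WeierstrassCurve.LInvariant_ne_zero` (and of `MahlerManinPadic`) is now the
height bound (H) for the classical modular polynomials of prime level, a theorem of analytic
nature (Mahler measures of `Φ_ℓ(X, j(τ))` over the `ψ(ℓ) = ℓ + 1` cosets) not yet in the tree.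

## References

* [BarreSirieixDiazGramainPhilibert1996Manin] K. Barré-Sirieix, G. Diaz, F. Gramain, G. Philibert,
  *Une preuve de la conjecture de Mahler–Manin*, Invent. Math. 124 (1996) 1–9, Théorème 1.
* [NesterenkoPhilippon2001] LNM 1752, Ch. 2 (G. Diaz), Lemma 2.5 ("`log L(Φ_n) ≤ C₀ ψ(n) log n` …
  the older result of K. Mahler (`log L(Φ_n) ≪ n^{3/2}`) would be sufficient"), Thm. 2.11.
* P. Cohen, *On the coefficients of the transformation polynomials for the elliptic modular
  function*, Math. Proc. Cambridge Philos. Soc. 95 (1984) 389–402.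
* R. Bröker, A. V. Sutherland, *An explicit height bound for the classical modular polynomial*,
  Ramanujan J. 22 (2010) 293–313, Thm. 1 (arXiv:0909.3442).
* D. A. Cox, *Primes of the form x² + ny²*, 2nd ed., Wiley 2013, Thm. 11.18. [Cox2013]
* [MazurTateTeitelbaum1986Invent] B. Mazur, J. Tate, J. Teitelbaum, Invent. Math. 84 (1986), §II.1.
-/

noncomputable section

open Finset Polynomial
open Literature.NumberTheory.EllipticCurves

namespace Literature.NumberTheory.Transcendental

/-- **The Mahler–Manin theorem (`p`-adic case) from the height of the modular polynomials.**  If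
the coefficients of the modular equations of prime level `Φ_ℓ = modularPolynomial ℓ` satisfy
`|coeff| ≤ exp(c ℓ √ℓ)` for an absolute constant `c` (a weak form of P. Cohen's 1984 theorem
`h(Φ_ℓ) = 6(ℓ+1)(log ℓ + O(1))`), then for every prime `p` and every algebraic `q ∈ ℚ_p` with
`0 < ‖q‖ < 1` the value `J(q) = E₄(q)³/Δ(q)` is transcendental (Barré-Sirieix–Diaz–Gramain–Philibert
1996, Théorème 1). [cite: BarreSirieixDiazGramainPhilibert1996Manin, Théorème 1] -/
theorem mahlerManinPadic_of_modularPolynomial_height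
    (hheight : ∃ c : ℝ, ∀ (ℓ : ℕ) [Fact ℓ.Prime], ∀ m i,
      ‖((modularPolynomial ℓ).coeff m).coeff i‖ ≤ Real.exp (c * ℓ * Real.sqrt ℓ)) :
    MahlerManinPadic := by
  classical
  obtain ⟨c, hc⟩ := hheight
  refine mahlerManinPadic_of_relations fun p _ q hq0 hq1 ↦ ?_
  -- the integer modular equations and their properties
  have key : ∀ ℓ : ℕ, ℓ.Prime → ∃ Φ : Polynomial (Polynomial ℤ), Φ.Monic ∧ Φ.natDegree = ℓ + 1 ∧
      (∀ m, (Φ.coeff m).natDegree ≤ ℓ + 1) ∧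
      (∀ m i, |(((Φ.coeff m).coeff i : ℤ) : ℝ)| ≤ Real.exp (c * ℓ * Real.sqrt ℓ)) ∧
      (Φ.map (Polynomial.eval₂RingHom (Int.castRingHom ℚ_[p]) (tateJ q))).eval (tateJ (q ^ ℓ)) = 0 := by
    intro ℓ hℓ
    haveI : Fact ℓ.Prime := ⟨hℓ⟩
    refine ⟨intModularPolynomial ℓ, monic_intModularPolynomial ℓ, natDegree_intModularPolynomial ℓ,
      natDegree_coeff_intModularPolynomial_le ℓ, fun m i ↦ ?_,
      modularRelation_padic ℓ (intModularPolynomial ℓ) (map_intModularPolynomial ℓ)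
        (natDegree_coeff_intModularPolynomial_le ℓ) hq0 hq1⟩
    have h := hc ℓ m i
    rw [← map_intModularPolynomial, Polynomial.coeff_map, Polynomial.coe_mapRingHom,
      Polynomial.coeff_map, eq_intCast, Complex.norm_intCast] at h
    exact h
  refine ⟨fun ℓ ↦ if h : ℓ.Prime then Classical.choose (key ℓ h) else 0, c, ?_, ?_, ?_, ?_, ?_⟩
  · intro ℓ hℓ; simp only [dif_pos hℓ]; exact (Classical.choose_spec (key ℓ hℓ)).1
  · intro ℓ hℓ; simp only [dif_pos hℓ]; exact (Classical.choose_spec (key ℓ hℓ)).2.1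
  · intro ℓ hℓ; simp only [dif_pos hℓ]; exact (Classical.choose_spec (key ℓ hℓ)).2.2.1
  · intro ℓ hℓ; simp only [dif_pos hℓ]; exact (Classical.choose_spec (key ℓ hℓ)).2.2.2.1
  · intro ℓ hℓ; simp only [dif_pos hℓ]; exact (Classical.choose_spec (key ℓ hℓ)).2.2.2.2

/-- **The Mahler–Manin theorem from the Bröker–Sutherland height bound.**  If every coefficient of
`Φ_ℓ = modularPolynomial ℓ`, `ℓ` prime, is bounded by `exp(6ℓ log ℓ + 16ℓ + 14√ℓ log ℓ)`
(Bröker–Sutherland 2010, Thm. 1: `h(Φ_ℓ) ≤ 6ℓ log ℓ + 16ℓ + 14√ℓ log ℓ`, `h = log max |coeff|`),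
then `MahlerManinPadic` holds. [cite: BarreSirieixDiazGramainPhilibert1996Manin, Théorème 1] -/
theorem mahlerManinPadic_of_brokerSutherland
    (hBS : ∀ (ℓ : ℕ) [Fact ℓ.Prime], ∀ m i, ‖((modularPolynomial ℓ).coeff m).coeff i‖ ≤
      Real.exp (6 * ℓ * Real.log ℓ + 16 * ℓ + 14 * Real.sqrt ℓ * Real.log ℓ)) :
    MahlerManinPadic := by
  refine mahlerManinPadic_of_modularPolynomial_height ⟨56, fun ℓ _ m i ↦ (hBS ℓ m i).trans ?_⟩
  rw [Real.exp_le_exp]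
  have hℓ1 : (1 : ℝ) ≤ ℓ := by exact_mod_cast (Fact.out : ℓ.Prime).one_lt.le
  have hℓ0 : (0 : ℝ) < ℓ := by linarith
  have hs1 : 1 ≤ Real.sqrt ℓ := by rw [← Real.sqrt_one]; exact Real.sqrt_le_sqrt hℓ1
  have hs0 : 0 ≤ Real.sqrt ℓ := Real.sqrt_nonneg _
  -- `log ℓ ≤ 2 √ℓ`
  have hlog : Real.log ℓ ≤ 2 * Real.sqrt ℓ := by
    have h := Real.log_le_sub_one_of_pos (Real.sqrt_pos.mpr hℓ0)
    rw [Real.log_sqrt hℓ0.le] at h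
    linarith
  have hlog0 : 0 ≤ Real.log ℓ := Real.log_nonneg hℓ1
  have hss : Real.sqrt ℓ * Real.sqrt ℓ = ℓ := Real.mul_self_sqrt hℓ0.le
  -- `6ℓ log ℓ ≤ 12 ℓ√ℓ`, `16ℓ ≤ 16 ℓ√ℓ`, `14 √ℓ log ℓ ≤ 28 ℓ ≤ 28 ℓ√ℓ`
  have e1 : 6 * ℓ * Real.log ℓ ≤ 12 * (ℓ * Real.sqrt ℓ) := by nlinarith
  have e2 : 16 * (ℓ : ℝ) ≤ 16 * (ℓ * Real.sqrt ℓ) := by nlinarith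
  have e3 : 14 * Real.sqrt ℓ * Real.log ℓ ≤ 28 * (ℓ * Real.sqrt ℓ) := by nlinarith
  linarith

/-- **`𝓛_p(E) ≠ 0` from the height of the modular polynomials.**  Under the hypothesis (H) of
`mahlerManinPadic_of_modularPolynomial_height`, Mazur–Tate–Teitelbaum's `𝓛`-invariant
`log_p q_E / ord_p q_E` of an elliptic curve over `ℚ` with a Tate parameter datum at `p` is nonzero
(`WeierstrassCurve.LInvariant_ne_zero`; Barré-Sirieix–Diaz–Gramain–Philibert 1996, corollary of
Théorème 1). [cite: BarreSirieixDiazGramainPhilibert1996Manin, Théorème 1] -/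
theorem lInvariant_ne_zero_of_modularPolynomial_height {W : WeierstrassCurve ℚ} {p : ℕ}
    [Fact p.Prime]
    (hheight : ∃ c : ℝ, ∀ (ℓ : ℕ) [Fact ℓ.Prime], ∀ m i,
      ‖((modularPolynomial ℓ).coeff m).coeff i‖ ≤ Real.exp (c * ℓ * Real.sqrt ℓ)) :
    WeierstrassCurve.LInvariant_ne_zero (W := W) (p := p) :=
  WeierstrassCurve.LInvariant_ne_zero_of_mahlerManin
    (mahlerManinPadic_of_modularPolynomial_height hheight)

/-- **`𝓛_p(E) ≠ 0` from the Bröker–Sutherland height bound** `h(Φ_ℓ) ≤ 6ℓ log ℓ + 16ℓ + 14√ℓ log ℓ`.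
[cite: BarreSirieixDiazGramainPhilibert1996Manin, Théorème 1] -/
theorem lInvariant_ne_zero_of_brokerSutherland {W : WeierstrassCurve ℚ} {p : ℕ} [Fact p.Prime]
    (hBS : ∀ (ℓ : ℕ) [Fact ℓ.Prime], ∀ m i, ‖((modularPolynomial ℓ).coeff m).coeff i‖ ≤
      Real.exp (6 * ℓ * Real.log ℓ + 16 * ℓ + 14 * Real.sqrt ℓ * Real.log ℓ)) :
    WeierstrassCurve.LInvariant_ne_zero (W := W) (p := p) :=
  WeierstrassCurve.LInvariant_ne_zero_of_mahlerManin (mahlerManinPadic_of_brokerSutherland hBS)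

end Literature.NumberTheory.Transcendental

end
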